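import Mathlib.NumberTheory.Padics.PadicIntegers
import Mathlib.GroupTheory.OrderOfElement
import HarnessLib

/-!
# K7r crux `EllipticUnitValueSeven` (stmt-BirchSwinnertonDyer-19705), line `rubin-formula`, stub S_dict
# `stub_localMordellWeilDictSeven`: the ABSTRACT `±`-CHART (eigen-decomposition under an involution,
# away from `2`; pure group theory; cell `bsd-cm`, seat `bsd-cm-k7r-c3` g6; helper file, `--supports` 19705)

HONEST FRAMING. Pure group theory; nothing about elliptic curves or the crux is asserted; BSD is not
proved by any of this. This is the abstract form of Silverman, *AEC*, Exercise 10.16 (the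
`Gal(L/F)`-eigenspace decomposition of `E(L)` for a quadratic `L = F(√c)`), in the shape the K7r
local Mordell–Weil dictionary needs (STUB-PLAN `stub_localMordellWeilDictSeven` L4, evidence #9 on 19705):

given abelian groups `X` (`= E(L)`), `A⁺` (`= E(F)`), `A⁻` (`= E^{(c)}(F)`), injective homomorphisms
`incl : A⁺ → X`, `τ : A⁻ → X`, an endomorphism `σ` of `X` with `σ ∘ incl = incl`, `σ ∘ τ = −τ`,
`x + σx ∈ im incl`, `x − σx ∈ im τ` for all `x` (the tree's `QuadraticDescent.conjMap_incl`,
`conjMap_twistMap`, `add_conjMap_mem_range_incl`, `sub_conjMap_mem_range_twistMap`), and CHARTS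
`λ⁺ : A⁺ → ℤ_p`, `λ⁻ : A⁻ → ℤ_p` (additive, kernel = torsion, onto; AEC VII.6.3 / the tree's `X11b.LocalIndex.psi`)
at an ODD prime `p` (`2u = 1` in `ℤ_p`), there is an additive

  `Φ : X → ℤ_p × ℤ_p`,  `Φ(x) = (u·λ⁺(incl⁻¹(x + σx)), u·λ⁻(τ⁻¹(x − σx)))`,

with KERNEL THE TORSION of `X`, ONTO, and `Φ(incl a + τ b) = (λ⁺ a, λ⁻ b)` (`exists_plusMinusChart`).
This is the chart fed to `KummerCore.relIndex_localKummer_eq_index_span_chart` for `X = E(K_𝔭)`,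
`F = ℚ_p`, `c = −p`. Reference: J. H. Silverman, *AEC* (2009), X.2 Prop. 2.4, Exercise 10.16, Prop. VII.6.3.
-/

set_option linter.dupNamespace false

noncomputable section

open scoped Classical

namespace Summit.BirchSwinnertonDyer.BirchSwinnertonDyer.Theorems.RamifiedSevenEllipticUnits.KummerCore

variable {p : ℕ} [Fact p.Prime]
variable {X Ap Am : Type*} [AddCommGroup X] [AddCommGroup Ap] [AddCommGroup Am]

/-- If `2 • x` has finite order then so does `x`. [folklore] -/
theorem isOfFinAddOrder_of_two_nsmul {x : X} (h : IsOfFinAddOrder (2 • x)) : IsOfFinAddOrder x := by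
  obtain ⟨n, hn, hnx⟩ := isOfFinAddOrder_iff_nsmul_eq_zero.1 h
  exact isOfFinAddOrder_iff_nsmul_eq_zero.2 ⟨n * 2, by omega, by rw [mul_nsmul', hnx]⟩

/-- **THE ABSTRACT `±`-CHART** (module docstring). Given the eigen-decomposition data
`(incl, τ, σ)` of `X` under an involution-like `σ` away from `2`, charts `λ⁺`, `λ⁻` with torsion kernel
onto `ℤ_p`, and `2u = 1` in `ℤ_p`: an additive `Φ : X → ℤ_p × ℤ_p` with kernel exactly the torsion of
`X`, onto, computed by `Φ x = (u λ⁺ a, u λ⁻ b)` whenever `incl a = x + σx`, `τ b = x − σx`, and with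
`Φ (incl a + τ b) = (λ⁺ a, λ⁻ b)`. Silverman, *AEC*, Exercise 10.16 (eigenspaces) with VII.6.3 (charts).
[cite: SilvermanAEC2009, Exercise 10.16] -/
theorem exists_plusMinusChart (incl : Ap →+ X) (τ : Am →+ X) (σ : X →+ X)
    (hincl : Function.Injective incl) (hτ : Function.Injective τ)
    (hσincl : ∀ a, σ (incl a) = incl a) (hστ : ∀ b, σ (τ b) = -τ b)
    (hplus : ∀ x, x + σ x ∈ incl.range) (hminus : ∀ x, x - σ x ∈ τ.range)
    (lp : Ap →+ ℤ_[p]) (lm : Am →+ ℤ_[p])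
    (hlp : ∀ a, lp a = 0 ↔ IsOfFinAddOrder a) (hlm : ∀ b, lm b = 0 ↔ IsOfFinAddOrder b)
    (hlps : Function.Surjective lp) (hlms : Function.Surjective lm) {u : ℤ_[p]} (hu : 2 * u = 1) :
    ∃ Φ : X →+ ℤ_[p] × ℤ_[p],
      (∀ x, Φ x = 0 ↔ IsOfFinAddOrder x) ∧ Function.Surjective Φ ∧
      (∀ (x : X) (a : Ap) (b : Am), incl a = x + σ x → τ b = x - σ x →
        Φ x = (u * lp a, u * lm b)) ∧
      (∀ (a : Ap) (b : Am), Φ (incl a + τ b) = (lp a, lm b)) := by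
  have hu0 : u ≠ 0 := by
    rintro rfl
    rw [mul_zero] at hu
    exact zero_ne_one hu
  -- the two projections `x ↦ incl⁻¹(x + σx)`, `x ↦ τ⁻¹(x − σx)`
  set f₁ : X →+ Ap := (AddMonoidHom.ofInjective hincl).symm.toAddMonoidHom.comp
    ((AddMonoidHom.id X + σ).codRestrict incl.range fun x ↦ hplus x) with hf₁
  set f₂ : X →+ Am := (AddMonoidHom.ofInjective hτ).symm.toAddMonoidHom.comp
    ((AddMonoidHom.id X - σ).codRestrict τ.range fun x ↦ hminus x) with hf₂
  have hf₁x : ∀ x, incl (f₁ x) = x + σ x := fun x ↦ by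
    rw [hf₁, AddMonoidHom.coe_comp, Function.comp_apply, AddEquiv.coe_toAddMonoidHom,
      AddMonoidHom.apply_ofInjective_symm]
    rfl
  have hf₂x : ∀ x, τ (f₂ x) = x - σ x := fun x ↦ by
    rw [hf₂, AddMonoidHom.coe_comp, Function.comp_apply, AddEquiv.coe_toAddMonoidHom,
      AddMonoidHom.apply_ofInjective_symm]
    rfl
  have hf₁eq : ∀ (x : X) (a : Ap), incl a = x + σ x → f₁ x = a := fun x a ha ↦
    hincl (by rw [hf₁x, ha])
  have hf₂eq : ∀ (x : X) (b : Am), τ b = x - σ x → f₂ x = b := fun x b hb ↦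
    hτ (by rw [hf₂x, hb])
  set Φ : X →+ ℤ_[p] × ℤ_[p] := ((AddMonoidHom.mulLeft u).comp (lp.comp f₁)).prod
    ((AddMonoidHom.mulLeft u).comp (lm.comp f₂)) with hΦ
  have hΦx : ∀ x, Φ x = (u * lp (f₁ x), u * lm (f₂ x)) := fun x ↦ rfl
  have hval : ∀ (x : X) (a : Ap) (b : Am), incl a = x + σ x → τ b = x - σ x →
      Φ x = (u * lp a, u * lm b) := fun x a b ha hb ↦ by
    rw [hΦx, hf₁eq x a ha, hf₂eq x b hb]
  have hsum : ∀ (a : Ap) (b : Am), Φ (incl a + τ b) = (lp a, lm b) := fun a b ↦ by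
    rw [hval (incl a + τ b) ((2 : ℕ) • a) ((2 : ℕ) • b)
      (by rw [map_add, hσincl, hστ, map_nsmul, two_nsmul]; abel)
      (by rw [map_add, hσincl, hστ, map_nsmul, two_nsmul]; abel),
      map_nsmul, map_nsmul, nsmul_eq_mul, nsmul_eq_mul, Nat.cast_ofNat, ← mul_assoc, ← mul_assoc,
      mul_comm u 2, hu, one_mul, one_mul]
  refine ⟨Φ, fun x ↦ ?_, fun v ↦ ?_, hval, hsum⟩
  · -- kernel = torsion
    rw [hΦx, Prod.mk_eq_zero, mul_eq_zero, mul_eq_zero, or_iff_right hu0, or_iff_right hu0, hlp, hlm,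
      ← hincl.isOfFinAddOrder_iff (f := incl), ← hτ.isOfFinAddOrder_iff (f := τ), hf₁x, hf₂x]
    constructor
    · rintro ⟨h1, h2⟩
      refine isOfFinAddOrder_of_two_nsmul ?_
      have : 2 • x = (x + σ x) + (x - σ x) := by rw [two_nsmul]; abel
      rw [this]
      exact h1.add h2
    · intro hx
      have hσx : IsOfFinAddOrder (σ x) := σ.isOfFinAddOrder hx
      exact ⟨hx.add hσx, by rw [sub_eq_add_neg]; exact hx.add hσx.neg⟩
  · -- onto
    obtain ⟨a, ha⟩ := hlps v.1
    obtain ⟨b, hb⟩ := hlms v.2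
    exact ⟨incl a + τ b, by rw [hsum, ha, hb]⟩

end Summit.BirchSwinnertonDyer.BirchSwinnertonDyer.Theorems.RamifiedSevenEllipticUnits.KummerCore

end
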